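import Summits.NavierStokesRegularity.FluidComputer.PalasekTowerGermHostStrictTiny

/-!
# The germ host — THE TAME CARRIER: a strict-slot filler of arbitrarily small scale-invariant size

Cell `ns-blowup`, seat `ns-blowup-ecbridge-3` (g8); GROUP C «BRIDGE SUPPORT» of the route
`PalasekTowerBreakdown` (crux `EpisodeBaseG`, item stmt-NavierStokesRegularity-19179, line `slot`).
Sequel of `PalasekTowerGermHostStrictTiny.lean` (the first kernel inhabitant `tinyProfile a + farPusher`
of the strict slot `Germ.LevelZeroData`). LABEL: E–C typing (KERNEL construction: two definitions with
body — the faint pusher and the tame carrier — and their calculus; everything proved). WHAT THIS IS NOT: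
not Navier–Stokes evidence — ONE explicit two-parameter family of compactly supported divergence-free
profiles passing the register's LEVEL-`0` READOUTS and the STRICT ANCHOR TEST at one instant, together
with the size of its `L³` norm; nothing about its Navier–Stokes evolution is proved HERE (that is the
sequel `PalasekTowerGermHostTameCarrierRun.lean`), nothing about `FirstEpisodeD`, `EpisodeBaseG`,
`RungG 1` or blow-up.

## Why (the superposition door of g7 and the one obligation it left)

After `palasekTowerBreakdown_episodeBase_of_superposed_freeRuns` (Theorems, p512842) the crux reads:
ONE free run of an amplifier meeting the first-window letter in its own frame ∧ ONE tame free run of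
SOME strict-slot carrier `U₁` on `[1, τfirst]`. The carrier of record `tinyProfile a + farPusher` (XIII)
has a pusher of speed `(15/32)Y₀` and size `5/4` — NOT small data. But the strict anchor test of the
flat, even blob needs from the pusher only the SIGN of its pressure push at the origin
(`inner_accel_pos_of_flat_forward`), invariant under `W ↦ λ W`, `λ ≠ 0`. Hence `faintPusher λ = λ • W`,
`tameCarrier a λ = tinyProfile a + faintPusher λ`; **`levelZeroData_tameCarrier`** (`0 < a ≤ 5/256`,
`a ≤ strainConst/256`, `0 < λ ≤ 1`); **`exists_levelZeroData_eLpNorm_le`**: for every `δ > 0` some tame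
carrier fills the strict slot with `‖tameCarrier a λ‖_{L³} ≤ δ` — small data for Kato's `L³` theory;
the sequel runs it under `2Y₀` on the whole first window.

References: S. Palasek, arXiv:2605.13827 §3.3 (host preparation before the first readout)
[cite: Palasek2026ElementaryModel, §3.3]; A. J. Majda, A. L. Bertozzi, *Vorticity and Incompressible
Flow* (CUP 2002), §1.8 Prop. 1.16 (Leray's formulation, the pressure as a quadratic functional)
[cite: MajdaBertozziCUP2002, §1.8 Prop. 1.16]; T. Kato, Math. Z. 187 (1984) 471–480 (the `L³`-size is
the relevant smallness) [cite: Kato1984, Thm. 2].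
-/

noncomputable section

namespace Summit.NavierStokesRegularity.FluidComputer.PalasekTowerClayBridge.Germ

open Set Function Filter Topology InnerProductSpace Metric MeasureTheory Real
open scoped Topology ContDiff RealInnerProductSpace ENNReal

open Literature.Analysis.FluidPDE TinyBlob

/-! ## §1 The faint pusher `λ • farPusher` -/

/-- **The faint pusher** `λ • W`, `W = farPusher` (XII). [folklore] -/
def faintPusher (lam : ℝ) : EuclideanSpace ℝ (Fin 3) → EuclideanSpace ℝ (Fin 3) :=
  fun x => lam • farPusher x

section Faint

variable {lam : ℝ}

/-- Pointwise form. [folklore] -/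
theorem faintPusher_apply (lam : ℝ) (x : EuclideanSpace ℝ (Fin 3)) :
    faintPusher lam x = lam • farPusher x := rfl

/-- The faint pusher is smooth. [folklore] -/
theorem contDiff_faintPusher (lam : ℝ) : ContDiff ℝ ∞ (faintPusher lam) := by
  show ContDiff ℝ ∞ (fun x => lam • farPusher x)
  exact (contDiff_const (c := lam)).smul contDiff_farPusher

/-- Its support lies in the pusher potential's. [folklore] -/
theorem tsupport_faintPusher_subset (lam : ℝ) : tsupport (faintPusher lam) ⊆ tsupport pusherPot :=
  (tsupport_smul_subset_right (fun _ => lam) farPusher).trans tsupport_farPusher_subset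

/-- It has compact support. [folklore] -/
theorem hasCompactSupport_faintPusher (lam : ℝ) : HasCompactSupport (faintPusher lam) :=
  IsCompact.of_isClosed_subset hasCompactSupport_pusherPot (isClosed_tsupport _)
    (tsupport_faintPusher_subset lam)

/-- It is divergence free. [folklore] -/
theorem isDivFree_faintPusher (lam : ℝ) : VectorCalculus.IsDivFree (faintPusher lam) :=
  VectorCalculus.IsDivFree.const_smul (contDiff_farPusher.differentiable (by simp)) isDivFree_farPusher lam

/-- It vanishes off the potential's support. [folklore] -/
theorem faintPusher_eq_zero {x : EuclideanSpace ℝ (Fin 3)} (hx : x ∉ tsupport pusherPot) :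
    faintPusher lam x = 0 := by rw [faintPusher_apply, farPusher_eq_zero hx, smul_zero]

/-- It vanishes on `B(0, 15/4)`. [folklore] -/
theorem faintPusher_eq_zero_of_norm_lt {x : EuclideanSpace ℝ (Fin 3)} (hx : ‖x‖ < 15 / 4) :
    faintPusher lam x = 0 := faintPusher_eq_zero (notMem_tsupport_of_norm_lt hx)

/-- `‖λ W‖ = |λ| ‖W‖`. [folklore] -/
theorem norm_faintPusher (lam : ℝ) (x : EuclideanSpace ℝ (Fin 3)) :
    ‖faintPusher lam x‖ = |lam| * ‖farPusher x‖ := by rw [faintPusher_apply, norm_smul, Real.norm_eq_abs]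

/-- `‖λ W‖ < Y₀` for `|λ| ≤ 1`. [folklore] -/
theorem norm_faintPusher_lt (hlam : |lam| ≤ 1) (x : EuclideanSpace ℝ (Fin 3)) :
    ‖faintPusher lam x‖ < TowerRates.wide.Y 0 := by
  rw [norm_faintPusher]
  have h1 := norm_farPusher_lt x
  have h2 : |lam| * ‖farPusher x‖ ≤ 1 * ‖farPusher x‖ :=
    mul_le_mul_of_nonneg_right hlam (norm_nonneg _)
  linarith

/-- `λ W ⊥ Y₀ e₃` pointwise. [folklore] -/
theorem inner_faintPusher_Y_smul_e₃ (lam : ℝ) (x : EuclideanSpace ℝ (Fin 3)) :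
    ⟪faintPusher lam x, TowerRates.wide.Y 0 • e₃⟫ = 0 := by
  rw [faintPusher_apply, real_inner_smul_left, real_inner_smul_right, inner_farPusher_e₃, mul_zero,
    mul_zero]

/-- The cone inequality on the support (scale invariant). [folklore] -/
theorem cone_faintPusher (lam : ℝ) {x : EuclideanSpace ℝ (Fin 3)} (hx : x ∈ tsupport pusherPot) :
    5 * ⟪0 - x, faintPusher lam x⟫ ^ 2 ≤ ‖0 - x‖ ^ 2 * ‖faintPusher lam x‖ ^ 2 := by
  have h := cone_farPusher hx
  rw [faintPusher_apply, real_inner_smul_right, norm_smul, Real.norm_eq_abs, mul_pow, mul_pow, sq_abs]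
  nlinarith [sq_nonneg lam]

/-- The STRICT cone inequality at the strict point, for `λ ≠ 0`. [folklore] -/
theorem cone_faintPusher_strictPt (hlam : lam ≠ 0) :
    5 * ⟪0 - strictPt, faintPusher lam strictPt⟫ ^ 2 <
      ‖0 - strictPt‖ ^ 2 * ‖faintPusher lam strictPt‖ ^ 2 := by
  have h := cone_strictPt
  have hl : 0 < lam ^ 2 := by positivity
  rw [faintPusher_apply, real_inner_smul_right, norm_smul, Real.norm_eq_abs, mul_pow, mul_pow, sq_abs]
  nlinarith

end Faint

/-! ## §2 The tame carrier `U = tinyProfile a + λ • farPusher` and its readouts -/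

/-- **THE TAME CARRIER** `U = tinyProfile a + faintPusher λ`. [folklore] -/
def tameCarrier (a lam : ℝ) : EuclideanSpace ℝ (Fin 3) → EuclideanSpace ℝ (Fin 3) :=
  tinyProfile a + faintPusher lam

section Carrier

variable {a lam : ℝ}

/-- Pointwise form. [folklore] -/
theorem tameCarrier_apply (a lam : ℝ) (x : EuclideanSpace ℝ (Fin 3)) :
    tameCarrier a lam x = tinyProfile a x + lam • farPusher x := rfl

/-- `U` is smooth. [folklore] -/
theorem contDiff_tameCarrier (a lam : ℝ) : ContDiff ℝ ∞ (tameCarrier a lam) :=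
  (contDiff_tinyProfile a).add (contDiff_faintPusher lam)

/-- Near the origin (`‖x‖ < 15/4`) the carrier is the blob. [folklore] -/
theorem tameCarrier_of_norm_lt {x : EuclideanSpace ℝ (Fin 3)} (hx : ‖x‖ < 15 / 4) :
    tameCarrier a lam x = tinyProfile a x := by
  rw [tameCarrier_apply, ← faintPusher_apply, faintPusher_eq_zero_of_norm_lt hx, add_zero]

/-- Far from the origin (`‖x‖ > 1`) it is the faint pusher. [folklore] -/
theorem tameCarrier_of_one_lt (ha : 0 < a) (h5 : a ≤ 5 / 256) {x : EuclideanSpace ℝ (Fin 3)}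
    (hx : 1 < ‖x‖) : tameCarrier a lam x = faintPusher lam x := by
  rw [tameCarrier_apply, tinyProfile_eq_zero_of_one_lt ha h5 hx, zero_add, faintPusher_apply]

/-- `U(0) = U₁(0) = Y₀ e₃`. [folklore] -/
theorem tameCarrier_zero (a lam : ℝ) : tameCarrier a lam 0 = tinyProfile a 0 := tameCarrier_of_norm_lt (by simp)

/-- `‖U(0)‖ = Y₀`. [folklore] -/
theorem norm_tameCarrier_zero (a lam : ℝ) : ‖tameCarrier a lam 0‖ = TowerRates.wide.Y 0 := by
  rw [tameCarrier_zero]; exact norm_tinyProfile_zero a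

/-- **Speed ceiling** `‖U‖ ≤ Y₀` (`|λ| ≤ 1`). [folklore] -/
theorem norm_tameCarrier_le (ha : 0 < a) (h5 : a ≤ 5 / 256) (hlam : |lam| ≤ 1)
    (x : EuclideanSpace ℝ (Fin 3)) : ‖tameCarrier a lam x‖ ≤ TowerRates.wide.Y 0 := by
  by_cases hx : ‖x‖ < 15 / 4
  · rw [tameCarrier_of_norm_lt hx]; exact norm_tinyProfile_le ha.ne' x
  · push Not at hx
    rw [tameCarrier_of_one_lt ha h5 (by linarith)]
    exact (norm_faintPusher_lt hlam x).le

/-- **The argmax is the origin**: `‖U x‖ = Y₀ → x = 0` (`|λ| ≤ 1`). [folklore] -/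
theorem eq_zero_of_norm_tameCarrier_eq (ha : 0 < a) (h5 : a ≤ 5 / 256) (hlam : |lam| ≤ 1)
    {x : EuclideanSpace ℝ (Fin 3)} (hx : ‖tameCarrier a lam x‖ = TowerRates.wide.Y 0) : x = 0 := by
  by_cases hn : ‖x‖ < 15 / 4
  · rw [tameCarrier_of_norm_lt hn] at hx; exact eq_zero_of_norm_tinyProfile_eq ha.ne' hx
  · push Not at hn
    rw [tameCarrier_of_one_lt ha h5 (by linarith)] at hx
    exact absurd hx (norm_faintPusher_lt hlam x).ne

/-- The supports of blob and faint pusher are disjoint. [folklore] -/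
theorem disjoint_tsupport_faintPusher (ha : 0 < a) (h5 : a ≤ 5 / 256) (lam : ℝ) :
    Disjoint (tsupport (tinyProfile a)) (tsupport (faintPusher lam)) :=
  (disjoint_tsupport ha h5).mono_right (tsupport_faintPusher_subset lam)

/-- **THE STRICT ANCHOR TEST AT EVERY VISCOSITY** for `λ ≠ 0`, `|λ| ≤ 1`:
`‖U x‖ = Y₀ → 0 < ⟪U x, accel ν U x⟫` — the blob is flat and even at its argmax, so the test value is
`λ²` times the (positive) pressure push of the full pusher. [cite: MajdaBertozziCUP2002, §1.8 Prop. 1.16] -/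
theorem anchor_tameCarrier (ha : 0 < a) (h5 : a ≤ 5 / 256) (hlam0 : lam ≠ 0) (hlam : |lam| ≤ 1)
    (ν : ℝ) (x : EuclideanSpace ℝ (Fin 3)) (hx : ‖tameCarrier a lam x‖ = TowerRates.wide.Y 0) :
    0 < ⟪tameCarrier a lam x, accel ν (tameCarrier a lam) x⟫ := by
  obtain rfl := eq_zero_of_norm_tameCarrier_eq ha h5 hlam hx
  rw [tameCarrier]
  have hfar : ∀ y ∈ tsupport (faintPusher lam), (1 : ℝ) < ‖(0 : EuclideanSpace ℝ (Fin 3)) - y‖ :=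
    fun y hy => by
      rw [zero_sub, norm_neg]
      linarith [(geometry_of_mem_tsupport (tsupport_faintPusher_subset lam hy)).2.2]
  have hperp : ∀ y, ⟪faintPusher lam y, tinyProfile a 0⟫ = 0 := fun y => by
    rw [tinyProfile_zero]; exact inner_faintPusher_Y_smul_e₃ lam y
  have hfwd : ∀ y ∈ tsupport (faintPusher lam), ⟪(0 : EuclideanSpace ℝ (Fin 3)) - y, tinyProfile a 0⟫ ≤ 0 :=
    fun y hy => by rw [tinyProfile_zero]; exact forward_farPusher (tsupport_faintPusher_subset lam hy)
  have hcone : ∀ y ∈ tsupport (faintPusher lam),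
      5 * ⟪(0 : EuclideanSpace ℝ (Fin 3)) - y, faintPusher lam y⟫ ^ 2 ≤
        ‖(0 : EuclideanSpace ℝ (Fin 3)) - y‖ ^ 2 * ‖faintPusher lam y‖ ^ 2 :=
    fun y hy => cone_faintPusher lam (tsupport_faintPusher_subset lam hy)
  have hfwd₁ : ⟪(0 : EuclideanSpace ℝ (Fin 3)) - strictPt, tinyProfile a 0⟫ < 0 := by
    rw [tinyProfile_zero]; exact forward_strictPt
  exact inner_accel_pos_of_flat_forward (contDiff_tinyProfile a) (hasCompactSupport_tinyProfile ha)
    (isDivFree_tinyProfile ha.ne') (isEvenAbout_tinyProfile a) (laplacian_tinyProfile_zero a)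
    (contDiff_faintPusher lam) (hasCompactSupport_faintPusher lam) (isDivFree_faintPusher lam)
    (disjoint_tsupport_faintPusher ha h5 lam) one_pos hfar hperp hfwd hcone hfwd₁
    (cone_faintPusher_strictPt hlam0)

/-- `tsupport U ⊆ B̄(0, 7)`. [folklore] -/
theorem tsupport_tameCarrier_subset (ha : 0 < a) (h5 : a ≤ 5 / 256) (lam : ℝ) :
    tsupport (tameCarrier a lam) ⊆ closedBall (0 : EuclideanSpace ℝ (Fin 3)) 7 := by
  refine closure_minimal (fun x hx => ?_) isClosed_closedBall
  rw [mem_closedBall, dist_zero_right]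
  by_contra hfar
  push Not at hfar
  refine hx ?_
  rw [tameCarrier_of_one_lt ha h5 (by linarith)]
  refine faintPusher_eq_zero fun hmem => ?_
  have h1 := (geometry_of_mem_tsupport hmem).1
  have : ‖x‖ ≤ ‖x - pusherCenter‖ + ‖pusherCenter‖ := norm_le_norm_sub_add x pusherCenter
  rw [norm_pusherCenter] at this
  linarith

/-- `U` has compact support. [folklore] -/
theorem hasCompactSupport_tameCarrier (ha : 0 < a) (h5 : a ≤ 5 / 256) (lam : ℝ) :
    HasCompactSupport (tameCarrier a lam) :=
  (isCompact_closedBall (0 : EuclideanSpace ℝ (Fin 3)) 7).of_isClosed_subset (isClosed_tsupport _)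
    (tsupport_tameCarrier_subset ha h5 lam)

/-- `U` is divergence free. [folklore] -/
theorem isDivFree_tameCarrier (ha : a ≠ 0) (lam : ℝ) : VectorCalculus.IsDivFree (tameCarrier a lam) := by
  intro x
  have h1 := isDivFree_tinyProfile ha x
  have h2 := isDivFree_faintPusher lam x
  simp only [VectorCalculus.divergence] at h1 h2 ⊢
  rw [tameCarrier, fderiv_add ((contDiff_tinyProfile a).differentiable (by simp) x)
    ((contDiff_faintPusher lam).differentiable (by simp) x)]
  push_cast
  rw [map_add, h1, h2, add_zero]

/-- Near the origin the Jacobian of `U` is the blob's. [folklore] -/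
theorem fderiv_tameCarrier_of_norm_lt {x : EuclideanSpace ℝ (Fin 3)} (hx : ‖x‖ < 15 / 4) :
    fderiv ℝ (tameCarrier a lam) x = fderiv ℝ (tinyProfile a) x := by
  have hev : tameCarrier a lam =ᶠ[𝓝 x] tinyProfile a := by
    have hopen : IsOpen {y : EuclideanSpace ℝ (Fin 3) | ‖y‖ < 15 / 4} :=
      isOpen_lt continuous_norm continuous_const
    filter_upwards [hopen.mem_nhds hx] with y hy
    exact tameCarrier_of_norm_lt hy
  exact hev.fderiv_eq

/-- **The strain floor** is the blob's. [folklore] -/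
theorem strain_tameCarrier (ha : 0 < a) (h5 : a ≤ 5 / 256) (hκ : a ≤ strainConst / 256) (lam : ℝ) :
    ∃ x : EuclideanSpace ℝ (Fin 3), ‖x‖ ≤ 7 ∧
      TowerRates.wide.A 0 ≤ ‖fderiv ℝ (tameCarrier a lam) x‖ := by
  have hn : ‖a • strainPt‖ ≤ 2 * a := by
    rw [norm_smul, Real.norm_eq_abs, abs_of_pos ha]; nlinarith [norm_strainPt_le]
  refine ⟨a • strainPt, by linarith, ?_⟩
  rw [fderiv_tameCarrier_of_norm_lt (by linarith)]
  exact strain_tinyProfile ha hκ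

/-- **The core loop** is the blob's (the faint pusher vanishes along it). [folklore] -/
theorem core_tameCarrier (ha : 0 < a) (h5 : a ≤ 5 / 256) (lam : ℝ) :
    ∃ (x : EuclideanSpace ℝ (Fin 3)) (γ : ℝ → EuclideanSpace ℝ (Fin 3)),
      ‖x‖ ≤ 7 ∧ ContDiff ℝ 1 γ ∧ γ 0 = γ 1 ∧
        (∀ s ∈ Icc (0 : ℝ) 1, γ s ∈ closedBall x (1 / TowerRates.wide.N 0)) ∧
        (∀ s ∈ Icc (0 : ℝ) 1, ‖deriv γ s‖ ≤ 8 * Real.pi / TowerRates.wide.N 0) ∧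
        TowerRates.wide.N 0 ^ (TowerRates.wide.β - 2) ≤ circulation (tameCarrier a lam) γ := by
  obtain ⟨x, γ, hx, hγ, h01, hball, hvel, hcirc⟩ := core_tinyProfile ha h5
  refine ⟨x, γ, by linarith, hγ, h01, hball, hvel, ?_⟩
  have hc : circulation (tameCarrier a lam) γ = circulation (tinyProfile a) γ := by
    unfold circulation
    refine intervalIntegral.integral_congr fun s hs => ?_
    rw [uIcc_of_le zero_le_one] at hs
    have hs' : ‖γ s‖ < 15 / 4 := by
      have hb := hball s hs
      rw [mem_closedBall, dist_eq_norm, Host.wide_N_zero] at hb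
      have : ‖γ s‖ ≤ ‖γ s - x‖ + ‖x‖ := norm_le_norm_sub_add (γ s) x
      linarith
    simp only [tameCarrier_of_norm_lt hs']
  rw [hc]
  exact hcirc

/-! ## §3 The strict slot is filled by every tame carrier -/

/-- **THE TAME CARRIER FILLS THE STRICT SLOT**: `LevelZeroData (tameCarrier a λ) 7` for `0 < a ≤ 5/256`,
`a ≤ strainConst/256`, `0 < λ ≤ 1`. [cite: Palasek2026ElementaryModel, §3.3] -/
theorem levelZeroData_tameCarrier (ha : 0 < a) (h5 : a ≤ 5 / 256) (hκ : a ≤ strainConst / 256)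
    (hlam : 0 < lam) (hlam1 : lam ≤ 1) : LevelZeroData (tameCarrier a lam) 7 :=
  have habs : |lam| ≤ 1 := by rw [abs_of_pos hlam]; exact hlam1
  { smooth := contDiff_tameCarrier a lam
    support := tsupport_tameCarrier_subset ha h5 lam
    divFree := isDivFree_tameCarrier ha.ne' lam
    ceiling := norm_tameCarrier_le ha h5 habs
    floor := ⟨0, by simp, (norm_tameCarrier_zero a lam).ge⟩
    strain := strain_tameCarrier ha h5 hκ lam
    core := core_tameCarrier ha h5 lam
    anchor := anchor_tameCarrier ha h5 hlam.ne' habs 1 }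

/-- The strict tiny scale works: `LevelZeroData (tameCarrier a λ) 7` for `0 < a ≤ strictTinyScale`,
`0 < λ ≤ 1`. [cite: Palasek2026ElementaryModel, §3.3] -/
theorem levelZeroData_tameCarrier_of_le (ha : 0 < a) (ha' : a ≤ strictTinyScale) (hlam : 0 < lam)
    (hlam1 : lam ≤ 1) : LevelZeroData (tameCarrier a lam) 7 :=
  levelZeroData_tameCarrier ha (ha'.trans (min_le_left _ _)) (ha'.trans (min_le_right _ _)) hlam hlam1

end Carrier

/-! ## §4 The `L³` size: tame carriers of arbitrarily small scale-invariant size -/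

section Size

variable {a lam : ℝ}

/-- `‖farPusher‖_{L³} < ∞` (continuous, compactly supported). [folklore] -/
theorem eLpNorm_farPusher_lt_top : eLpNorm farPusher 3 volume < ⊤ :=
  (contDiff_farPusher.continuous.memLp_of_hasCompactSupport hasCompactSupport_farPusher).eLpNorm_lt_top

/-- `‖λ W‖_{L³} = |λ| ‖W‖_{L³}`. [folklore] -/
theorem eLpNorm_faintPusher (lam : ℝ) :
    eLpNorm (faintPusher lam) 3 volume = ENNReal.ofReal |lam| * eLpNorm farPusher 3 volume := by
  have h : faintPusher lam = lam • farPusher := rfl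
  rw [h, eLpNorm_const_smul, Real.enorm_eq_ofReal_abs]

/-- **The faint pusher is `L³`-small**: `‖faintPusher λ‖₃ ≤ δ` for
`0 < λ ≤ δ / (‖farPusher‖₃ + 1)`. [folklore] -/
theorem eLpNorm_faintPusher_le {δ : ℝ} (hlam : 0 ≤ lam)
    (hle : lam * ((eLpNorm farPusher 3 volume).toReal + 1) ≤ δ) :
    eLpNorm (faintPusher lam) 3 volume ≤ ENNReal.ofReal δ := by
  rw [eLpNorm_faintPusher, abs_of_nonneg hlam,
    ← ENNReal.ofReal_toReal eLpNorm_farPusher_lt_top.ne, ← ENNReal.ofReal_mul hlam]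
  refine ENNReal.ofReal_le_ofReal ?_
  have hP : 0 ≤ (eLpNorm farPusher 3 volume).toReal := ENNReal.toReal_nonneg
  nlinarith

/-- **`‖U‖₃ ≤ ‖tinyProfile a‖₃ + ‖faintPusher λ‖₃`**. [folklore] -/
theorem eLpNorm_tameCarrier_le (a lam : ℝ) :
    eLpNorm (tameCarrier a lam) 3 volume ≤
      eLpNorm (tinyProfile a) 3 volume + eLpNorm (faintPusher lam) 3 volume := by
  rw [tameCarrier]
  exact eLpNorm_add_le (contDiff_tinyProfile a).continuous.aestronglyMeasurable
    (contDiff_faintPusher lam).continuous.aestronglyMeasurable (by norm_num)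

/-- **TAME CARRIERS OF ARBITRARILY SMALL `L³` SIZE FILL THE STRICT SLOT**: for every `δ > 0` there are
`0 < a ≤ strictTinyScale` and `0 < λ ≤ 1` with `LevelZeroData (tameCarrier a λ) 7` and
`‖tameCarrier a λ‖_{L³} ≤ δ` (half the budget for the blob, `eLpNorm_tinyProfile_le_of_small`; half for
the faint pusher). [cite: Palasek2026ElementaryModel, §3.3] [cite: Kato1984, Thm. 2] -/
theorem exists_levelZeroData_eLpNorm_le {δ : ℝ} (hδ : 0 < δ) :
    ∃ a lam : ℝ, 0 < a ∧ a ≤ strictTinyScale ∧ 0 < lam ∧ lam ≤ 1 ∧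
      LevelZeroData (tameCarrier a lam) 7 ∧
      eLpNorm (tameCarrier a lam) 3 volume ≤ ENNReal.ofReal δ := by
  have hY := Host.wide_Y_zero_pos
  have hv := unitBallVol_nonneg
  -- the blob scale: `a ≤ strictTinyScale ≤ 1` and `8 a (|B̄₁| + 1) Y₀³ ≤ (δ/2)³`
  set D : ℝ := 8 * (unitBallVol + 1) * TowerRates.wide.Y 0 ^ 3 with hD
  have hDpos : 0 < D := by positivity
  set a : ℝ := min strictTinyScale ((δ / 2) ^ 3 / D) with ha
  have ha0 : 0 < a := lt_min strictTinyScale_pos (by positivity)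
  have haS : a ≤ strictTinyScale := min_le_left _ _
  have ha1 : a ≤ 1 := haS.trans ((min_le_left _ _).trans (by norm_num))
  have hsmall : 8 * a * (unitBallVol + 1) * TowerRates.wide.Y 0 ^ 3 ≤ (δ / 2) ^ 3 := by
    have h1 : a ≤ (δ / 2) ^ 3 / D := min_le_right _ _
    rw [le_div_iff₀ hDpos] at h1
    calc 8 * a * (unitBallVol + 1) * TowerRates.wide.Y 0 ^ 3 = a * D := by rw [hD]; ring
      _ ≤ (δ / 2) ^ 3 := h1
  have hblob := eLpNorm_tinyProfile_le_of_small ha0 ha1 (half_pos hδ) hsmall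
  -- the pusher scale
  set P : ℝ := (eLpNorm farPusher 3 volume).toReal with hP
  have hP0 : 0 ≤ P := ENNReal.toReal_nonneg
  set lam : ℝ := min 1 ((δ / 2) / (P + 1)) with hlam
  have hlam0 : 0 < lam := lt_min one_pos (by positivity)
  have hlam1 : lam ≤ 1 := min_le_left _ _
  have hpush : eLpNorm (faintPusher lam) 3 volume ≤ ENNReal.ofReal (δ / 2) := by
    refine eLpNorm_faintPusher_le hlam0.le ?_
    have h1 : lam ≤ (δ / 2) / (P + 1) := min_le_right _ _
    rwa [le_div_iff₀ (by positivity)] at h1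
  refine ⟨a, lam, ha0, haS, hlam0, hlam1, levelZeroData_tameCarrier_of_le ha0 haS hlam0 hlam1, ?_⟩
  calc eLpNorm (tameCarrier a lam) 3 volume
      ≤ eLpNorm (tinyProfile a) 3 volume + eLpNorm (faintPusher lam) 3 volume :=
        eLpNorm_tameCarrier_le a lam
    _ ≤ ENNReal.ofReal (δ / 2) + ENNReal.ofReal (δ / 2) := add_le_add hblob hpush
    _ = ENNReal.ofReal δ := by rw [← ENNReal.ofReal_add (by positivity) (by positivity)]; ring_nf

/-- The same with the three hypotheses a free-run theorem consumes spelled out: smooth, compactly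
supported, divergence free, speed `≤ Y₀`, `‖U‖₃ ≤ δ`, and the strict slot. [cite: Palasek2026ElementaryModel, §3.3] -/
theorem exists_levelZeroData_small (δ : ℝ) (hδ : 0 < δ) :
    ∃ U : EuclideanSpace ℝ (Fin 3) → EuclideanSpace ℝ (Fin 3),
      LevelZeroData U 7 ∧ ContDiff ℝ ∞ U ∧ HasCompactSupport U ∧ VectorCalculus.IsDivFree U ∧
      (∀ x, ‖U x‖ ≤ TowerRates.wide.Y 0) ∧ (eLpNorm U 3 volume).toReal ≤ δ := by
  obtain ⟨a, lam, ha0, haS, hlam0, hlam1, hLZ, hL3⟩ := exists_levelZeroData_eLpNorm_le hδ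
  refine ⟨tameCarrier a lam, hLZ, hLZ.smooth, hLZ.hasCompactSupport, hLZ.divFree, hLZ.ceiling, ?_⟩
  have hlt : eLpNorm (tameCarrier a lam) 3 volume < ⊤ := hL3.trans_lt ENNReal.ofReal_lt_top
  have := (ENNReal.toReal_le_toReal hlt.ne ENNReal.ofReal_ne_top).2 hL3
  rwa [ENNReal.toReal_ofReal hδ.le] at this

end Size

end Summit.NavierStokesRegularity.FluidComputer.PalasekTowerClayBridge.Germ

end
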